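import Mathlib
import HarnessLib
import Literature.NumberTheory.GaloisRepresentations.GaloisRepOfLadicLimit

/-!
# Galois representations as ALGEBRA-VALUED `ℓ`-adic limits (Taylor's argument, family form)

Topic `Literature/NumberTheory/GaloisRepresentations`; a PROOFS file (theorems only: no definitions,
no named facts).  Written for the crux `GaloisRepOfUnitaryLDS` (stmt-Langlands-15129, line `Sketch`,
stub `stub_algebraValuedLimit`), whose Theorems-side stub is a one-line wrapper of
`exists_semisimple_galoisRep_of_algebraValuedLimit`.

Taylor's pseudo-representation argument (Taylor 1991 §1; Goldring–Koskivirta 2019 §11.1,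
arXiv:1507.05032 p. 40: "The compositions `θ_n ∘ R` form a `𝔭`-adic system of
pseudo-representations. Hence their limit gives a `ℚ̄_p`-valued pseudo-representation …") in its
FAITHFUL, Hecke-ALGEBRA-valued form.  The tree theorem
`Literature.NumberTheory.GaloisRepresentations.exists_semisimple_galoisRep_of_ladicLimit` asks, for
every precision `m`, for ONE representation `ρ'_m` whose Frobenius polynomials are within `ℓ^{-m}`
of the prescribed ones; the printed engines (GK Thm. 3.4.1/3.5.6, Pilloni–Stroh) only give, per
`m`, a FINITE FAMILY `ρ'_{m,i}` (the Galois representations of the regular eigenforms of a Hecke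
algebra `T_m`) and a continuous ring homomorphism `θ_m : T_m → 𝒪/ℓ^m` carrying Frobenius data to
the prescription.  Extensionally (no Hecke-algebra object): there is `δ_m > 0` such that every
INTEGER polynomial `F` in the Frobenius-coefficient variables `X_{(v,k)}` at good places with
`‖F(charpoly ρ'_{m,i}(Frob_v))‖ ≤ δ_m` for all `i` has `‖F(P_v)‖ ≤ ℓ^{-m}`.  Under that hypothesis
`exists_semisimple_galoisRep_of_algebraValuedLimit` produces the continuous semisimple `ρ` with
`charpoly ρ(Frob_v) = P_v`.

## Proof

1. *Cells.*  For each `m` the coefficient map `c_m : Γ_K → (i, k) ↦ coeff_k charpoly ρ'_{m,i}` is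
   continuous into a finite product of copies of `ℚ̄_ℓ`; its closed `δ_m`-cells (sup-distance
   `≤ δ_m`) partition `Γ_K` into OPEN sets (ultrametric), each meeting the dense set `D` of good
   Frobenii (Chebotarev, `absoluteGaloisGroup.frobenius_dense`).  Choosing one good Frobenius per
   cell (`exists_cellRepresentative`) and transporting the prescription gives LOCALLY CONSTANT
   `t_{m,k} : Γ_K → E`; on `D` it is within `ℓ^{-m}` of the prescription (the inequality applied to
   `X_{(v',k)} - X_{(v,k)}`).
2. *Limits.*  `LadicLimit.exists_continuous_limit_of_dense`: `t_{m,k} → T_k` uniformly, `T_k`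
   continuous `E`-valued, `T_k(Frob_v) = coeff_k P_v`.
3. *Transfer.*  Every integer-polynomial identity among the charpoly coefficients of the
   `ρ'_{m,i}` at finitely many group elements (valid for all `m`, `i`) transfers to the `T_k`:
   approximate the elements simultaneously by good Frobenii inside their cells (a `Filter.pi` of
   `𝓝[D]`), apply the inequality to the renamed polynomial, and pass to the limit.
4. *Pseudocharacter.*  `Tr := -T_{n-1}`: `Tr(1) = n` (transfer of `tr 1 = n`), centrality
   (`charpoly(gh) = charpoly(hg)` puts `gh`, `hg` in one cell), and the Frobenius identity
   `S_{n+1}(Tr) = 0` (the universal identity over the free monoid, `frobeniusS_eq_aeval_freeMonoid`,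
   transferred from `Rouquier1996_prop_3_1_trace_holds`).  Taylor's theorem
   (`BellaicheChenevier2009_continuous_rep_of_pseudocharacter_holds`) gives semisimple `ρ` with
   `tr ρ = Tr`.
5. *Characteristic polynomials* of `ρ` from traces of powers (transfer of
   `tr(A^j) = p_j(roots)`, Newton: `LadicLimit.multiset_eq_of_psum_eq`), *unramifiedness* (inertia
   does not move cells; `apply_eq_one_of_mem_charpolyKer`) and *Frobenius* (`T_k = coeff_k P_v` on
   Frobenii) as in the single-approximant proof.

References: R. Taylor, Duke Math. J. 63 (1991) §1; W. Goldring, J.-S. Koskivirta, Invent. Math.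
217 (2019) Thm. 3.5.6 and §11.1; J. Bellaïche, G. Chenevier, Astérisque 324 (2009) §1.2.
-/

noncomputable section

open scoped NumberField Polynomial
open Filter Topology Polynomial Field IsDedekindDomain NumberField
open Literature.NumberTheory.GaloisRepresentations Literature.NumberTheory.Automorphic

namespace Literature.NumberTheory.GaloisRepresentations

/-! ### The universal Frobenius functional -/

/-- **The Frobenius functional is a universal integer polynomial.**  `S_d(T)(x)` is the
evaluation, at `w ↦ T(w(x))`, of the integer polynomial `S_d(X)(of)` in the variables
`X_w` (`w` a word in the free monoid on `d` letters) — naturality of `S_d` in the monoid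
(`frobeniusS_comp`) and in the coefficients (`frobeniusS_map`). [folklore] -/
theorem frobeniusS_eq_aeval_freeMonoid {G : Type*} [Monoid G] {A : Type*} [CommRing A]
    (T : G → A) (d : ℕ) (x : Fin d → G) :
    frobeniusS T d x =
      MvPolynomial.aeval (fun w : FreeMonoid (Fin d) => T (FreeMonoid.lift x w))
        (frobeniusS (fun w : FreeMonoid (Fin d) =>
          (MvPolynomial.X w : MvPolynomial (FreeMonoid (Fin d)) ℤ)) d FreeMonoid.of) := by
  have h1 : x = (FreeMonoid.lift x) ∘ FreeMonoid.of := by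
    funext i; simp
  conv_lhs => rw [h1, ← frobeniusS_comp T (FreeMonoid.lift x) d FreeMonoid.of]
  have h2 : (T ∘ (FreeMonoid.lift x) : FreeMonoid (Fin d) → A) =
      ((MvPolynomial.aeval (R := ℤ) (fun w : FreeMonoid (Fin d) => T (FreeMonoid.lift x w))).toRingHom :
        MvPolynomial (FreeMonoid (Fin d)) ℤ → A) ∘
        (fun w : FreeMonoid (Fin d) => (MvPolynomial.X w : MvPolynomial (FreeMonoid (Fin d)) ℤ)) := by
    funext w; simp
  rw [h2, frobeniusS_map]
  rfl

/-! ### Cells of a continuous map into a finite product of copies of `ℚ̄_ℓ` -/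

section Cells

variable {ℓ : ℕ} [Fact ℓ.Prime]

/-- **Cell representatives.**  Let `c : X → (ι → ℚ̄_ℓ)` be continuous (`ι` finite), `δ > 0`, and
`D ⊆ X` dense.  The relation "`‖c x i - c y i‖ ≤ δ` for all `i`" is an equivalence relation with
OPEN classes (ultrametric inequality; closed balls of positive radius are open), so every class
meets `D`, and one can choose a representative `d x ∈ D` of the class of `x` depending only on the
class; the resulting `d : X → X` is locally constant. [folklore] -/
theorem exists_cellRepresentative {X : Type*} [TopologicalSpace X] {D : Set X} (hD : Dense D)
    {ι : Type*} [Finite ι] (c : X → ι → PadicAlgCl ℓ) (hc : Continuous c) {δ : ℝ} (hδ : 0 < δ) :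
    ∃ d : X → X, (∀ x, d x ∈ D ∧ ∀ i, ‖c (d x) i - c x i‖ ≤ δ) ∧
      (∀ x y, (∀ i, ‖c x i - c y i‖ ≤ δ) → d x = d y) ∧ IsLocallyConstant d := by
  classical
  -- the relation and its basic properties
  set R : X → X → Prop := fun x y => ∀ i, ‖c x i - c y i‖ ≤ δ with hR
  have hrefl : ∀ x, R x x := fun x i => by simp [hδ.le]
  have hsymm : ∀ {x y}, R x y → R y x := fun h i => by rw [norm_sub_rev]; exact h i
  have htrans : ∀ {x y z}, R x y → R y z → R x z := by
    intro x y z hxy hyz i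
    have e : c x i - c z i = (c x i - c y i) + (c y i - c z i) := by ring
    rw [e]
    exact (IsUltrametricDist.norm_add_le_max _ _).trans (max_le (hxy i) (hyz i))
  have hopen : ∀ x, IsOpen {y | R x y} := by
    intro x
    have e : {y | R x y} = ⋂ i, (fun y => c y i) ⁻¹' Metric.closedBall (c x i) δ := by
      ext y
      simp only [Set.mem_setOf_eq, Set.mem_iInter, Set.mem_preimage, Metric.mem_closedBall,
        dist_eq_norm, hR]
      refine forall_congr' fun i => ?_
      rw [norm_sub_rev]
    rw [e]
    refine isOpen_iInter_of_finite fun i => ?_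
    exact (IsUltrametricDist.isOpen_closedBall (c x i) hδ.ne').preimage
      ((continuous_apply i).comp hc)
  -- the choice, depending only on the class
  have hne : ∀ x, ∃ z, z ∈ D ∧ R z x := by
    intro x
    obtain ⟨z, hzU, hzD⟩ := hD.inter_open_nonempty {y | R x y} (hopen x) ⟨x, hrefl x⟩
    exact ⟨z, hzD, hsymm hzU⟩
  let d : X → X := fun x => @Classical.epsilon X ⟨x⟩ (fun z => z ∈ D ∧ R z x)
  have hd : ∀ x, d x ∈ D ∧ R (d x) x := fun x =>
    @Classical.epsilon_spec X (fun z => z ∈ D ∧ R z x) (hne x)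
  have hdeq : ∀ x y, R x y → d x = d y := by
    intro x y hxy
    have e : (fun z => z ∈ D ∧ R z x) = (fun z => z ∈ D ∧ R z y) := by
      funext z
      exact propext ⟨fun h => ⟨h.1, htrans h.2 hxy⟩, fun h => ⟨h.1, htrans h.2 (hsymm hxy)⟩⟩
    show @Classical.epsilon X ⟨x⟩ (fun z => z ∈ D ∧ R z x) =
      @Classical.epsilon X ⟨y⟩ (fun z => z ∈ D ∧ R z y)
    rw [e]
  refine ⟨d, hd, hdeq, ?_⟩
  rw [IsLocallyConstant.iff_eventually_eq]
  intro x
  filter_upwards [(hopen x).mem_nhds (hrefl x)] with y hy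
  exact (hdeq x y hy).symm

end Cells

/-! ### The theorem -/

section Main

variable {ℓ : ℕ} [Fact ℓ.Prime]

/-- Continuity of `x ↦ F(x)` for an integer polynomial `F` in any set of variables (product
topology on the inputs). [folklore] -/
theorem continuous_mvPolynomial_aeval {σ : Type*} {A : Type*} [CommRing A] [TopologicalSpace A]
    [IsTopologicalRing A] (F : MvPolynomial σ ℤ) :
    Continuous fun x : σ → A => MvPolynomial.aeval x F := by
  have e : (fun x : σ → A => MvPolynomial.aeval x F) =
      fun x => MvPolynomial.eval x (MvPolynomial.map (Int.castRingHom A) F) := by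
    funext x
    rw [MvPolynomial.eval_map, MvPolynomial.aeval_def,
      Subsingleton.elim (algebraMap ℤ A) (Int.castRingHom A)]
  rw [e]
  exact MvPolynomial.continuous_eval _

/-- **Exact identities at good places transfer to the prescription.**  If an integer polynomial
in good Frobenius-coefficient variables VANISHES on the Frobenius data of every member of every
approximating family, it vanishes on the prescribed data (`‖F(P)‖ ≤ ℓ^{-m}` for all `m`).
[folklore] -/
theorem aeval_eq_zero_of_forall_family {K : Type} [Field K] [NumberField K]
    (S : Set (HeightOneSpectrum (𝓞 K))) (P : HeightOneSpectrum (𝓞 K) → (PadicAlgCl ℓ)[X])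
    (r : ℕ → ℕ) (Q : (m : ℕ) → Fin (r m) → HeightOneSpectrum (𝓞 K) → (PadicAlgCl ℓ)[X])
    (δ : ℕ → ℝ)
    (hineq : ∀ (m : ℕ) (F : MvPolynomial (HeightOneSpectrum (𝓞 K) × ℕ) ℤ),
      (∀ vk ∈ F.vars, vk.1 ∉ S ∧ ((ℓ : ℕ) : 𝓞 K) ∉ vk.1.asIdeal) →
      (∀ i, ‖MvPolynomial.aeval
          (fun vk : HeightOneSpectrum (𝓞 K) × ℕ => (Q m i vk.1).coeff vk.2) F‖ ≤ δ m) →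
        ‖MvPolynomial.aeval (fun vk : HeightOneSpectrum (𝓞 K) × ℕ => (P vk.1).coeff vk.2) F‖ ≤
          (ℓ : ℝ) ^ (-(m : ℤ)))
    (hδ : ∀ m, 0 < δ m) (F : MvPolynomial (HeightOneSpectrum (𝓞 K) × ℕ) ℤ)
    (hF : ∀ vk ∈ F.vars, vk.1 ∉ S ∧ ((ℓ : ℕ) : 𝓞 K) ∉ vk.1.asIdeal)
    (h0 : ∀ m i, MvPolynomial.aeval
      (fun vk : HeightOneSpectrum (𝓞 K) × ℕ => (Q m i vk.1).coeff vk.2) F = 0) :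
    MvPolynomial.aeval (fun vk : HeightOneSpectrum (𝓞 K) × ℕ => (P vk.1).coeff vk.2) F = 0 := by
  have hb : ∀ m : ℕ, ‖MvPolynomial.aeval
      (fun vk : HeightOneSpectrum (𝓞 K) × ℕ => (P vk.1).coeff vk.2) F‖ ≤ (ℓ : ℝ) ^ (-(m : ℤ)) :=
    fun m => hineq m F hF fun i => by rw [h0 m i, norm_zero]; exact (hδ m).le
  rw [← norm_le_zero_iff]
  exact ge_of_tendsto' (LadicLimit.tendsto_zpow_neg_natCast (ℓ := ℓ)) hb

/-- **The rank-zero case** (degenerate): every `0`-dimensional representation is trivial,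
semisimple and unramified, and the inequality forces `P_v = 1 = charpoly` of the empty matrix.
[folklore] -/
theorem algebraValuedLimit_rank_zero (K : Type) [Field K] [NumberField K]
    (S : Set (HeightOneSpectrum (𝓞 K)))
    (P : HeightOneSpectrum (𝓞 K) → (PadicAlgCl ℓ)[X])
    (happrox : ∀ m : ℕ, ∃ (r : ℕ) (ρ' : Fin r → FramedGaloisRep K (PadicAlgCl ℓ) 0)
        (Q : Fin r → HeightOneSpectrum (𝓞 K) → (PadicAlgCl ℓ)[X]) (δ : ℝ), 0 < δ ∧
        (∀ i, ∀ v ∉ S, ((ℓ : ℕ) : 𝓞 K) ∉ v.asIdeal →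
          (ρ' i).IsUnramifiedAt v ∧ (ρ' i).HasFrobCharpolyAt v (Q i v)) ∧
        ∀ F : MvPolynomial (HeightOneSpectrum (𝓞 K) × ℕ) ℤ,
          (∀ vk ∈ F.vars, vk.1 ∉ S ∧ ((ℓ : ℕ) : 𝓞 K) ∉ vk.1.asIdeal) →
          (∀ i, ‖MvPolynomial.aeval
              (fun vk : HeightOneSpectrum (𝓞 K) × ℕ => (Q i vk.1).coeff vk.2) F‖ ≤ δ) →
            ‖MvPolynomial.aeval
                (fun vk : HeightOneSpectrum (𝓞 K) × ℕ => (P vk.1).coeff vk.2) F‖ ≤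
              (ℓ : ℝ) ^ (-(m : ℤ))) :
    ∃ ρ : FramedGaloisRep K (PadicAlgCl ℓ) 0, ρ.toGaloisRep.IsSemisimple ∧
      ∀ v ∉ S, ((ℓ : ℕ) : 𝓞 K) ∉ v.asIdeal → ρ.IsUnramifiedAt v ∧ ρ.HasFrobCharpolyAt v (P v) := by
  classical
  choose r ρ' Q δ hδ hρ' hineq using happrox
  refine ⟨1, ?_, fun v hv hℓv => ⟨fun 𝔓 _ τ _ => by simp, fun 𝔓 h𝔓 σ hσ => ?_⟩⟩
  · haveI : Subsingleton (Subrepresentation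
        ((1 : FramedGaloisRep K (PadicAlgCl ℓ) 0).toGaloisRep.toRepresentation)) :=
      ⟨fun a b => Subrepresentation.toSubmodule_injective (Subsingleton.elim _ _)⟩
    exact Subsingleton.instComplementedLattice
  · -- every `0 × 0` characteristic polynomial is `1`; the inequality forces `P v = 1` too
    have h1 : ∀ (ρ₀ : FramedGaloisRep K (PadicAlgCl ℓ) 0) (g : absoluteGaloisGroup K),
        FramedRep.charpoly ρ₀ g = 1 := fun ρ₀ g => by
      simp [FramedRep.charpoly, Matrix.charpoly, Matrix.det_isEmpty]
    rw [h1]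
    have hQ : ∀ m i, Q m i v = 1 := fun m i => by rw [← (hρ' m i v hv hℓv).2 𝔓 h𝔓 σ hσ, h1]
    have hvars : ∀ k : ℕ, ∀ vk ∈ (MvPolynomial.X (v, k) :
        MvPolynomial (HeightOneSpectrum (𝓞 K) × ℕ) ℤ).vars,
        vk.1 ∉ S ∧ ((ℓ : ℕ) : 𝓞 K) ∉ vk.1.asIdeal := by
      intro k vk hvk
      rw [MvPolynomial.vars_X, Finset.mem_singleton] at hvk
      subst hvk
      exact ⟨hv, hℓv⟩
    ext k
    by_cases hk0 : k = 0
    · subst hk0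
      have h := aeval_eq_zero_of_forall_family S P r Q δ hineq hδ (MvPolynomial.X (v, 0) - 1)
        ?_ ?_
      · rw [map_sub, map_one, MvPolynomial.aeval_X, sub_eq_zero] at h
        rw [h, Polynomial.coeff_one_zero]
      · intro vk hvk
        have h' := MvPolynomial.vars_sub_subset _ hvk
        rw [MvPolynomial.vars_one, Finset.union_empty] at h'
        exact hvars 0 vk h'
      · intro m i
        rw [map_sub, map_one, MvPolynomial.aeval_X, hQ m i, Polynomial.coeff_one_zero, sub_self]
    · have h := aeval_eq_zero_of_forall_family S P r Q δ hineq hδ (MvPolynomial.X (v, k))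
        (hvars k) ?_
      · rw [MvPolynomial.aeval_X] at h
        rw [h, Polynomial.coeff_one, if_neg hk0]
      · intro m i
        rw [MvPolynomial.aeval_X, hQ m i, Polynomial.coeff_one, if_neg hk0]

/-- **Transferable limits of the Frobenius-coefficient prescriptions** (Steps 1–3 of the module
docstring).  From the approximating families and the factorisation inequality one gets continuous
`E`-valued functions `T_k : Γ_K → ℚ̄_ℓ` (`k ∈ ℕ`) with `T_k(Frob_v) = coeff_k P_v` at every good
`v`, `T_n = 1`, `T_k = 0` for `k > n`, equal at any two elements with identical family data, and
the TRANSFER property: an integer-polynomial identity among the characteristic-polynomial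
coefficients of all the `ρ'_{m,i}` at finitely many group elements holds for the `T_k`.
[cite: Taylor1991, §1 Theorem 1] [cite: GoldringKoskivirta2019, §11.1 and Thm. 3.5.6] -/
theorem exists_transferableLimit (K : Type) [Field K] [NumberField K] (n : ℕ)
    (E : IntermediateField ℚ_[ℓ] (PadicAlgCl ℓ)) [FiniteDimensional ℚ_[ℓ] E]
    (S : Set (HeightOneSpectrum (𝓞 K))) (hS : S.Finite)
    (P : HeightOneSpectrum (𝓞 K) → (PadicAlgCl ℓ)[X])
    (hP : ∀ v ∉ S, ∀ k : ℕ, (P v).coeff k ∈ E)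
    (r : ℕ → ℕ) (ρ' : (m : ℕ) → Fin (r m) → FramedGaloisRep K (PadicAlgCl ℓ) n)
    (Q : (m : ℕ) → Fin (r m) → HeightOneSpectrum (𝓞 K) → (PadicAlgCl ℓ)[X]) (δ : ℕ → ℝ)
    (hδ : ∀ m, 0 < δ m)
    (hρ' : ∀ (m : ℕ) (i : Fin (r m)), ∀ v ∉ S, ((ℓ : ℕ) : 𝓞 K) ∉ v.asIdeal →
      (ρ' m i).IsUnramifiedAt v ∧ (ρ' m i).HasFrobCharpolyAt v (Q m i v))
    (hineq : ∀ (m : ℕ) (F : MvPolynomial (HeightOneSpectrum (𝓞 K) × ℕ) ℤ),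
      (∀ vk ∈ F.vars, vk.1 ∉ S ∧ ((ℓ : ℕ) : 𝓞 K) ∉ vk.1.asIdeal) →
      (∀ i, ‖MvPolynomial.aeval
          (fun vk : HeightOneSpectrum (𝓞 K) × ℕ => (Q m i vk.1).coeff vk.2) F‖ ≤ δ m) →
        ‖MvPolynomial.aeval (fun vk : HeightOneSpectrum (𝓞 K) × ℕ => (P vk.1).coeff vk.2) F‖ ≤
          (ℓ : ℝ) ^ (-(m : ℤ))) :
    ∃ T : ℕ → absoluteGaloisGroup K → PadicAlgCl ℓ,
      (∀ k, Continuous (T k)) ∧ (∀ k g, T k g ∈ E) ∧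
      (∀ (v : HeightOneSpectrum (𝓞 K)), v ∉ S → ((ℓ : ℕ) : 𝓞 K) ∉ v.asIdeal →
        ∀ 𝔓 ∈ v.primesAbove, ∀ σ, IsArithFrobAt (𝓞 K) σ 𝔓 → ∀ k, T k σ = (P v).coeff k) ∧
      (∀ g, T n g = 1) ∧ (∀ g k, n < k → T k g = 0) ∧
      (∀ x y : absoluteGaloisGroup K,
        (∀ m (i : Fin (r m)), FramedRep.charpoly (ρ' m i) x = FramedRep.charpoly (ρ' m i) y) →
        ∀ k, T k x = T k y) ∧
      ∀ (W : Type) [Fintype W] (w : W → absoluteGaloisGroup K) (F : MvPolynomial (W × ℕ) ℤ),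
        (∀ (m : ℕ) (i : Fin (r m)), MvPolynomial.aeval
          (fun ak : W × ℕ => (FramedRep.charpoly (ρ' m i) (w ak.1)).coeff ak.2) F = 0) →
        MvPolynomial.aeval (fun ak : W × ℕ => T ak.2 (w ak.1)) F = 0 := by
  classical
  set rr : ℕ → ℝ := fun m => (ℓ : ℝ) ^ (-(m : ℤ)) with hrr
  have hrr_lim : Tendsto rr atTop (𝓝 0) := LadicLimit.tendsto_zpow_neg_natCast
  have nsub : ∀ a b : PadicAlgCl ℓ, ‖a - b‖ ≤ max ‖a‖ ‖b‖ := fun a b => by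
    simpa [sub_eq_add_neg, norm_neg] using IsUltrametricDist.norm_add_le_max a (-b)
  -- the finite exceptional set `S' = S ∪ {v ∣ ℓ}` and the dense set of good Frobenii
  have hSℓ : {v : HeightOneSpectrum (𝓞 K) | ((ℓ : ℕ) : 𝓞 K) ∈ v.asIdeal}.Finite := by
    have hI : (Ideal.span {((ℓ : ℕ) : 𝓞 K)} : Ideal (𝓞 K)) ≠ ⊥ := by
      rw [Ne, Ideal.span_singleton_eq_bot]
      exact_mod_cast (Fact.out : ℓ.Prime).ne_zero
    refine (Ideal.finite_factors hI).subset fun v hv => ?_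
    exact Ideal.dvd_iff_le.mpr ((Ideal.span_singleton_le_iff_mem _).mpr hv)
  set S' : Set (HeightOneSpectrum (𝓞 K)) := S ∪ {v | ((ℓ : ℕ) : 𝓞 K) ∈ v.asIdeal} with hS'def
  have hS' : S'.Finite := hS.union hSℓ
  have hD := absoluteGaloisGroup.frobenius_dense chebotarev_artinRep_holds K S' hS'
  set D : Set (absoluteGaloisGroup K) :=
    {σ | ∃ v ∉ S', ∃ 𝔓 ∈ v.primesAbove, IsArithFrobAt (𝓞 K) σ 𝔓} with hDdef
  have hDv : ∀ σ ∈ D, ∃ v : HeightOneSpectrum (𝓞 K), v ∉ S ∧ ((ℓ : ℕ) : 𝓞 K) ∉ v.asIdeal ∧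
      ∃ 𝔓 ∈ v.primesAbove, IsArithFrobAt (𝓞 K) σ 𝔓 := by
    rintro σ ⟨v, hv, 𝔓, h𝔓, hσ⟩
    exact ⟨v, fun h => hv (Or.inl h), fun h => hv (Or.inr h), 𝔓, h𝔓, hσ⟩
  have hmemD : ∀ (v : HeightOneSpectrum (𝓞 K)), v ∉ S → ((ℓ : ℕ) : 𝓞 K) ∉ v.asIdeal →
      ∀ 𝔓 ∈ v.primesAbove, ∀ σ, IsArithFrobAt (𝓞 K) σ 𝔓 → σ ∈ D :=
    fun v hv hℓv 𝔓 h𝔓 σ hσ => ⟨v, fun h => h.elim hv hℓv, 𝔓, h𝔓, hσ⟩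
  -- the prescription transported to good Frobenii (through a chosen place)
  let tP : ℕ → absoluteGaloisGroup K → PadicAlgCl ℓ :=
    fun k σ => if hσ : σ ∈ D then (P (hDv σ hσ).choose).coeff k else 0
  have htPE : ∀ k, ∀ d ∈ D, tP k d ∈ E := by
    intro k d hd
    simp only [tP, dif_pos hd]
    exact hP _ (hDv d hd).choose_spec.1 k
  -- Frobenius data of the families at good Frobenii
  have hQfrob : ∀ (m : ℕ) (i : Fin (r m)) (v : HeightOneSpectrum (𝓞 K)), v ∉ S →
      ((ℓ : ℕ) : 𝓞 K) ∉ v.asIdeal → ∀ 𝔓 ∈ v.primesAbove, ∀ σ, IsArithFrobAt (𝓞 K) σ 𝔓 →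
        FramedRep.charpoly (ρ' m i) σ = Q m i v :=
    fun m i v hv hℓv 𝔓 h𝔓 σ hσ => (hρ' m i v hv hℓv).2 𝔓 h𝔓 σ hσ
  -- Step 1: coefficient maps of the families, their cells, locally constant interpolants
  let c : (m : ℕ) → absoluteGaloisGroup K → (Fin (r m) × Fin (n + 1) → PadicAlgCl ℓ) :=
    fun m g ik => (FramedRep.charpoly (ρ' m ik.1) g).coeff ik.2
  have hc_cont : ∀ m, Continuous (c m) := fun m =>
    continuous_pi fun ik => LadicLimit.continuous_coeff_charpoly (ρ' m ik.1) ik.2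
  have hcell := fun m => exists_cellRepresentative hD (c m) (hc_cont m) (hδ m)
  choose dsel hdsel hdsel_eq hdsel_lc using hcell
  let t : ℕ → ℕ → absoluteGaloisGroup K → PadicAlgCl ℓ := fun m k x => tP k (dsel m x)
  have ht_cont : ∀ m k, Continuous (t m k) := fun m k => ((hdsel_lc m).comp (tP k)).continuous
  have ht_eq : ∀ m k x y, (∀ ik, ‖c m x ik - c m y ik‖ ≤ δ m) → t m k x = t m k y := by
    intro m k x y h
    show tP k (dsel m x) = tP k (dsel m y)
    rw [hdsel_eq m x y h]
  -- cell-closeness of two group elements controls every charpoly coefficient of the family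
  have hcoeff_close : ∀ (m : ℕ) (x y : absoluteGaloisGroup K),
      (∀ ik, ‖c m x ik - c m y ik‖ ≤ δ m) → ∀ (i : Fin (r m)) (k : ℕ),
        ‖(FramedRep.charpoly (ρ' m i) x).coeff k - (FramedRep.charpoly (ρ' m i) y).coeff k‖ ≤ δ m := by
    intro m x y h i k
    by_cases hk : k ≤ n
    · exact h (i, ⟨k, Nat.lt_succ_of_le hk⟩)
    · replace hk := not_le.1 hk
      rw [coeff_eq_zero_of_natDegree_lt (by rw [LadicLimit.natDegree_charpoly]; exact hk),
        coeff_eq_zero_of_natDegree_lt (by rw [LadicLimit.natDegree_charpoly]; exact hk),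
        sub_self, norm_zero]
      exact (hδ m).le
  -- KEY USE (i) of the inequality: two good Frobenii in one cell carry `ℓ^{-m}`-close prescriptions
  have hclose : ∀ (m k : ℕ), ∀ d ∈ D, ∀ d' ∈ D, (∀ ik, ‖c m d' ik - c m d ik‖ ≤ δ m) →
      ‖tP k d' - tP k d‖ ≤ rr m := by
    intro m k d hd d' hd' hR
    obtain ⟨hvS, hvℓ, 𝔓, h𝔓, hfr⟩ := (hDv d hd).choose_spec
    obtain ⟨hvS', hvℓ', 𝔓', h𝔓', hfr'⟩ := (hDv d' hd').choose_spec
    have h := hineq m (MvPolynomial.X ((hDv d' hd').choose, k) - MvPolynomial.X ((hDv d hd).choose, k))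
      ?_ ?_
    · simpa only [tP, dif_pos hd, dif_pos hd', map_sub, MvPolynomial.aeval_X] using h
    · intro vk hvk
      have h' := MvPolynomial.vars_sub_subset _ hvk
      simp only [MvPolynomial.vars_X, Finset.mem_union, Finset.mem_singleton] at h'
      rcases h' with rfl | rfl
      · exact ⟨hvS', hvℓ'⟩
      · exact ⟨hvS, hvℓ⟩
    · intro i
      rw [map_sub, MvPolynomial.aeval_X, MvPolynomial.aeval_X,
        ← hQfrob m i _ hvS' hvℓ' 𝔓' h𝔓' d' hfr', ← hQfrob m i _ hvS hvℓ 𝔓 h𝔓 d hfr]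
      exact hcoeff_close m d' d hR i k
  have happ : ∀ k m, ∀ d ∈ D, ‖t m k d - tP k d‖ ≤ rr m := fun k m d hd =>
    hclose m k d hd (dsel m d) (hdsel m d).1 (hdsel m d).2
  -- Step 2: uniform limits
  have hT : ∀ k, ∃ Tk : absoluteGaloisGroup K → PadicAlgCl ℓ, Continuous Tk ∧ (∀ g, Tk g ∈ E) ∧
      (∀ m g, ‖t m k g - Tk g‖ ≤ rr m) ∧ ∀ d ∈ D, Tk d = tP k d := fun k =>
    LadicLimit.exists_continuous_limit_of_dense hD E (fun m => t m k) (fun m => ht_cont m k) (tP k)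
      (htPE k) (happ k)
  choose T hT_cont hT_E hT_bd hT_D using hT
  have hT_lim : ∀ k g, Tendsto (fun m => t m k g) atTop (𝓝 (T k g)) := by
    intro k g
    refine tendsto_iff_norm_sub_tendsto_zero.2 ?_
    exact squeeze_zero (fun m => norm_nonneg _) (fun m => hT_bd k m g) hrr_lim
  -- group elements with IDENTICAL family data have the same limits
  have hT_eq_of_c : ∀ x y : absoluteGaloisGroup K,
      (∀ m (i : Fin (r m)), FramedRep.charpoly (ρ' m i) x = FramedRep.charpoly (ρ' m i) y) →
      ∀ k, T k x = T k y := by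
    intro x y h k
    refine tendsto_nhds_unique (hT_lim k x) ?_
    have e : (fun m => t m k x) = fun m => t m k y := funext fun m =>
      ht_eq m k x y fun ik => by
        show ‖(FramedRep.charpoly (ρ' m ik.1) x).coeff ik.2 -
          (FramedRep.charpoly (ρ' m ik.1) y).coeff ik.2‖ ≤ δ m
        rw [h m ik.1, sub_self, norm_zero]; exact (hδ m).le
    rw [e]
    exact hT_lim k y
  -- values at good Frobenii: `T_k(Frob_v) = coeff_k P_v` (KEY USE (ii), exact transfer)
  have hT_frob : ∀ (v : HeightOneSpectrum (𝓞 K)), v ∉ S → ((ℓ : ℕ) : 𝓞 K) ∉ v.asIdeal →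
      ∀ 𝔓 ∈ v.primesAbove, ∀ σ, IsArithFrobAt (𝓞 K) σ 𝔓 → ∀ k, T k σ = (P v).coeff k := by
    intro v hv hℓv 𝔓 h𝔓 σ hσ k
    have hσD : σ ∈ D := hmemD v hv hℓv 𝔓 h𝔓 σ hσ
    rw [hT_D k σ hσD]
    obtain ⟨hvS₀, hvℓ₀, 𝔓₀, h𝔓₀, hfr₀⟩ := (hDv σ hσD).choose_spec
    simp only [tP, dif_pos hσD]
    have h := aeval_eq_zero_of_forall_family S P r Q δ hineq hδ
      (MvPolynomial.X ((hDv σ hσD).choose, k) - MvPolynomial.X (v, k)) ?_ ?_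
    · rwa [map_sub, MvPolynomial.aeval_X, MvPolynomial.aeval_X, sub_eq_zero] at h
    · intro vk hvk
      have h' := MvPolynomial.vars_sub_subset _ hvk
      simp only [MvPolynomial.vars_X, Finset.mem_union, Finset.mem_singleton] at h'
      rcases h' with rfl | rfl
      · exact ⟨hvS₀, hvℓ₀⟩
      · exact ⟨hv, hℓv⟩
    · intro m i
      rw [map_sub, MvPolynomial.aeval_X, MvPolynomial.aeval_X,
        ← hQfrob m i _ hvS₀ hvℓ₀ 𝔓₀ h𝔓₀ σ hfr₀, ← hQfrob m i v hv hℓv 𝔓 h𝔓 σ hσ, sub_self]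
  -- the prescribed polynomials at good places are monic of degree `n` (exact transfer)
  have hP_top : ∀ (v : HeightOneSpectrum (𝓞 K)), v ∉ S → ((ℓ : ℕ) : 𝓞 K) ∉ v.asIdeal →
      (P v).coeff n = 1 ∧ ∀ k, n < k → (P v).coeff k = 0 := by
    intro v hv hℓv
    obtain ⟨𝔓, h𝔓⟩ := HeightOneSpectrum.primesAbove_nonempty v
    obtain ⟨σ, hσ⟩ := HeightOneSpectrum.exists_isArithFrobAt_of_mem_primesAbove_holds h𝔓
    have hvars : ∀ k : ℕ, ∀ vk ∈ (MvPolynomial.X (v, k) :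
        MvPolynomial (HeightOneSpectrum (𝓞 K) × ℕ) ℤ).vars,
        vk.1 ∉ S ∧ ((ℓ : ℕ) : 𝓞 K) ∉ vk.1.asIdeal := by
      intro k vk hvk
      rw [MvPolynomial.vars_X, Finset.mem_singleton] at hvk
      subst hvk
      exact ⟨hv, hℓv⟩
    have hmon : ∀ m i, (FramedRep.charpoly (ρ' m i) σ).coeff n = 1 := fun m i => by
      have h := (Matrix.charpoly_monic ((ρ' m i σ : GL (Fin n) (PadicAlgCl ℓ)) :
        Matrix (Fin n) (Fin n) (PadicAlgCl ℓ))).coeff_natDegree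
      rwa [Matrix.charpoly_natDegree_eq_dim, Fintype.card_fin] at h
    constructor
    · have h := aeval_eq_zero_of_forall_family S P r Q δ hineq hδ (MvPolynomial.X (v, n) - 1) ?_ ?_
      · rwa [map_sub, map_one, MvPolynomial.aeval_X, sub_eq_zero] at h
      · intro vk hvk
        have h' := MvPolynomial.vars_sub_subset _ hvk
        rw [MvPolynomial.vars_one, Finset.union_empty] at h'
        exact hvars n vk h'
      · intro m i
        rw [map_sub, map_one, MvPolynomial.aeval_X, ← hQfrob m i v hv hℓv 𝔓 h𝔓 σ hσ, hmon, sub_self]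
    · intro k hk
      have h := aeval_eq_zero_of_forall_family S P r Q δ hineq hδ (MvPolynomial.X (v, k)) (hvars k) ?_
      · rwa [MvPolynomial.aeval_X] at h
      · intro m i
        rw [MvPolynomial.aeval_X, ← hQfrob m i v hv hℓv 𝔓 h𝔓 σ hσ]
        exact coeff_eq_zero_of_natDegree_lt (by rw [LadicLimit.natDegree_charpoly]; exact hk)
  -- Step 3: THE TRANSFER LEMMA — integer-polynomial identities among charpoly coefficients of
  -- the families at finitely many group elements pass to the limits `T_k`
  have htransfer : ∀ (W : Type) [Fintype W] (w : W → absoluteGaloisGroup K)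
      (F : MvPolynomial (W × ℕ) ℤ),
      (∀ (m : ℕ) (i : Fin (r m)), MvPolynomial.aeval
        (fun ak : W × ℕ => (FramedRep.charpoly (ρ' m i) (w ak.1)).coeff ak.2) F = 0) →
      MvPolynomial.aeval (fun ak : W × ℕ => T ak.2 (w ak.1)) F = 0 := by
    intro W _ w F hF
    -- for each `m`, inputs `y_m` within `ℓ^{-m}` of the target with `‖F(y_m)‖ ≤ ℓ^{-m}`
    have key : ∀ m, ∃ y : W × ℕ → PadicAlgCl ℓ, ‖MvPolynomial.aeval y F‖ ≤ rr m ∧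
        ∀ ak, ‖y ak - T ak.2 (w ak.1)‖ ≤ rr m := by
      intro m
      haveI : ∀ a, (𝓝[D] (w a)).NeBot := fun a => mem_closure_iff_nhdsWithin_neBot.1 (hD (w a))
      set 𝓕 : Filter (W → absoluteGaloisGroup K) := Filter.pi fun a => 𝓝[D] (w a) with h𝓕def
      have h𝓕le : 𝓕 ≤ 𝓝 w := by
        rw [nhds_pi]
        exact Filter.pi_mono fun a => nhdsWithin_le_nhds
      -- the families' evaluation of `F` at a tuple of group elements
      let G : (W → absoluteGaloisGroup K) → (Fin (r m) → PadicAlgCl ℓ) := fun gv i =>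
        MvPolynomial.aeval (fun ak : W × ℕ => (FramedRep.charpoly (ρ' m i) (gv ak.1)).coeff ak.2) F
      have hG_cont : Continuous G := by
        refine continuous_pi fun i => (continuous_mvPolynomial_aeval F).comp ?_
        exact continuous_pi fun ak =>
          (LadicLimit.continuous_coeff_charpoly (ρ' m i) ak.2).comp (continuous_apply ak.1)
      have hGw : G w = 0 := funext fun i => hF m i
      have hG_tend : Tendsto G 𝓕 (𝓝 0) := by
        have h := (hG_cont.tendsto w).mono_left h𝓕le
        rwa [hGw] at h
      have h1 : ∀ᶠ gv in 𝓕, ∀ i, ‖G gv i‖ < δ m := by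
        filter_upwards [(Metric.tendsto_nhds.1 hG_tend) (δ m) (hδ m)] with gv hgv i
        rw [dist_zero_right] at hgv
        exact (norm_le_pi_norm (G gv) i).trans_lt hgv
      have h2 : ∀ᶠ gv in 𝓕, ∀ a, gv a ∈ D ∧ ∀ ik, ‖c m (gv a) ik - c m (w a) ik‖ ≤ δ m := by
        refine eventually_all.2 fun a => ?_
        have ho : IsOpen {g : absoluteGaloisGroup K | ∀ ik, ‖c m g ik - c m (w a) ik‖ ≤ δ m} := by
          have e : {g : absoluteGaloisGroup K | ∀ ik, ‖c m g ik - c m (w a) ik‖ ≤ δ m} =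
              ⋂ ik, (fun g => c m g ik) ⁻¹' Metric.closedBall (c m (w a) ik) (δ m) := by
            ext g; simp [dist_eq_norm]
          rw [e]
          exact isOpen_iInter_of_finite fun ik =>
            (IsUltrametricDist.isOpen_closedBall _ (hδ m).ne').preimage
              ((continuous_apply ik).comp (hc_cont m))
        have hU : {g : absoluteGaloisGroup K | ∀ ik, ‖c m g ik - c m (w a) ik‖ ≤ δ m} ∈ 𝓝 (w a) :=
          ho.mem_nhds fun ik => by simp [(hδ m).le]
        have hmem : ∀ᶠ g in 𝓝[D] (w a), g ∈ D ∧ ∀ ik, ‖c m g ik - c m (w a) ik‖ ≤ δ m :=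
          Filter.inter_mem self_mem_nhdsWithin (mem_nhdsWithin_of_mem_nhds hU)
        exact (Filter.tendsto_eval_pi (fun a => 𝓝[D] (w a)) a).eventually hmem
      obtain ⟨gv, hgv1, hgv2⟩ := (h1.and h2).exists
      have hgD : ∀ a, gv a ∈ D := fun a => (hgv2 a).1
      -- the chosen places of the approximating Frobenii
      let pl : W → HeightOneSpectrum (𝓞 K) := fun a => (hDv (gv a) (hgD a)).choose
      have hpl : ∀ a, pl a ∉ S ∧ ((ℓ : ℕ) : 𝓞 K) ∉ (pl a).asIdeal ∧
          ∃ 𝔓 ∈ (pl a).primesAbove, IsArithFrobAt (𝓞 K) (gv a) 𝔓 := fun a =>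
        (hDv (gv a) (hgD a)).choose_spec
      have hTy : ∀ ak : W × ℕ, T ak.2 (gv ak.1) = (P (pl ak.1)).coeff ak.2 := by
        intro ak
        obtain ⟨hS₁, hℓ₁, 𝔓, h𝔓, hfr⟩ := hpl ak.1
        exact hT_frob (pl ak.1) hS₁ hℓ₁ 𝔓 h𝔓 (gv ak.1) hfr ak.2
      refine ⟨fun ak => T ak.2 (gv ak.1), ?_, ?_⟩
      · -- KEY USE (iii) of the inequality, on the renamed polynomial
        let θ : W × ℕ → HeightOneSpectrum (𝓞 K) × ℕ := fun ak => (pl ak.1, ak.2)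
        have hvars : ∀ vk ∈ (MvPolynomial.rename θ F).vars,
            vk.1 ∉ S ∧ ((ℓ : ℕ) : 𝓞 K) ∉ vk.1.asIdeal := by
          intro vk hvk
          obtain ⟨ak, -, rfl⟩ := Finset.mem_image.1 (MvPolynomial.vars_rename θ F hvk)
          exact ⟨(hpl ak.1).1, (hpl ak.1).2.1⟩
        have h := hineq m (MvPolynomial.rename θ F) hvars ?_
        · rw [MvPolynomial.aeval_rename] at h
          have e : (fun vk : HeightOneSpectrum (𝓞 K) × ℕ => (P vk.1).coeff vk.2) ∘ θ =
              fun ak : W × ℕ => T ak.2 (gv ak.1) := funext fun ak => (hTy ak).symm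
          rwa [e] at h
        · intro i
          rw [MvPolynomial.aeval_rename]
          have e : (fun vk : HeightOneSpectrum (𝓞 K) × ℕ => (Q m i vk.1).coeff vk.2) ∘ θ =
              fun ak : W × ℕ => (FramedRep.charpoly (ρ' m i) (gv ak.1)).coeff ak.2 := by
            funext ak
            obtain ⟨hS₁, hℓ₁, 𝔓, h𝔓, hfr⟩ := hpl ak.1
            simp only [Function.comp_apply, θ]
            rw [hQfrob m i (pl ak.1) hS₁ hℓ₁ 𝔓 h𝔓 (gv ak.1) hfr]
          rw [e]
          exact (hgv1 i).le
      · intro ak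
        have hcell : t m ak.2 (gv ak.1) = t m ak.2 (w ak.1) := ht_eq m ak.2 _ _ (hgv2 ak.1).2
        have e : T ak.2 (gv ak.1) - T ak.2 (w ak.1) =
            (t m ak.2 (w ak.1) - T ak.2 (w ak.1)) - (t m ak.2 (gv ak.1) - T ak.2 (gv ak.1)) := by
          rw [hcell]; ring
        rw [e]
        exact (nsub _ _).trans (max_le (hT_bd _ m _) (hT_bd _ m _))
    choose y hy1 hy2 using key
    have hylim : Tendsto y atTop (𝓝 fun ak : W × ℕ => T ak.2 (w ak.1)) := by
      refine tendsto_pi_nhds.2 fun ak => tendsto_iff_norm_sub_tendsto_zero.2 ?_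
      exact squeeze_zero (fun m => norm_nonneg _) (fun m => hy2 m ak) hrr_lim
    have hlim : Tendsto (fun m => MvPolynomial.aeval (y m) F) atTop
        (𝓝 (MvPolynomial.aeval (fun ak : W × ℕ => T ak.2 (w ak.1)) F)) :=
      ((continuous_mvPolynomial_aeval F).tendsto _).comp hylim
    rw [← norm_le_zero_iff]
    exact le_of_tendsto_of_tendsto ((continuous_norm.tendsto _).comp hlim) hrr_lim
      (Eventually.of_forall fun m => hy1 m)
  -- the top coefficients of the limits: `T_n = 1`, `T_k = 0` for `k > n`
  have hT_n : ∀ g, T n g = 1 := by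
    intro g
    refine tendsto_nhds_unique (hT_lim n g) ?_
    have e : (fun m => t m n g) = fun _ => (1 : PadicAlgCl ℓ) := funext fun m => by
      have hd := (hdsel m g).1
      show tP n (dsel m g) = 1
      simp only [tP, dif_pos hd]
      exact (hP_top _ (hDv _ hd).choose_spec.1 (hDv _ hd).choose_spec.2.1).1
    rw [e]
    exact tendsto_const_nhds
  have hT_gt : ∀ g k, n < k → T k g = 0 := by
    intro g k hk
    refine tendsto_nhds_unique (hT_lim k g) ?_
    have e : (fun m => t m k g) = fun _ => (0 : PadicAlgCl ℓ) := funext fun m => by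
      have hd := (hdsel m g).1
      show tP k (dsel m g) = 0
      simp only [tP, dif_pos hd]
      exact (hP_top _ (hDv _ hd).choose_spec.1 (hDv _ hd).choose_spec.2.1).2 k hk
    rw [e]
    exact tendsto_const_nhds
  exact ⟨T, hT_cont, hT_E, hT_frob, hT_n, hT_gt, hT_eq_of_c, htransfer⟩

/-- **The algebra-valued `ℓ`-adic limit theorem in positive rank** (the heart of the file; see the
module docstring for the proof). [cite: Taylor1991, §1 Theorem 1] [cite: GoldringKoskivirta2019, §11.1 and Thm. 3.5.6] -/
theorem algebraValuedLimit_pos_rank (K : Type) [Field K] [NumberField K] (n : ℕ) (hn : 0 < n)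
    (E : IntermediateField ℚ_[ℓ] (PadicAlgCl ℓ)) [FiniteDimensional ℚ_[ℓ] E]
    (S : Set (HeightOneSpectrum (𝓞 K))) (hS : S.Finite)
    (P : HeightOneSpectrum (𝓞 K) → (PadicAlgCl ℓ)[X])
    (hP : ∀ v ∉ S, ∀ k : ℕ, (P v).coeff k ∈ E)
    (happrox : ∀ m : ℕ, ∃ (r : ℕ) (ρ' : Fin r → FramedGaloisRep K (PadicAlgCl ℓ) n)
        (Q : Fin r → HeightOneSpectrum (𝓞 K) → (PadicAlgCl ℓ)[X]) (δ : ℝ), 0 < δ ∧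
        (∀ i, ∀ v ∉ S, ((ℓ : ℕ) : 𝓞 K) ∉ v.asIdeal →
          (ρ' i).IsUnramifiedAt v ∧ (ρ' i).HasFrobCharpolyAt v (Q i v)) ∧
        ∀ F : MvPolynomial (HeightOneSpectrum (𝓞 K) × ℕ) ℤ,
          (∀ vk ∈ F.vars, vk.1 ∉ S ∧ ((ℓ : ℕ) : 𝓞 K) ∉ vk.1.asIdeal) →
          (∀ i, ‖MvPolynomial.aeval
              (fun vk : HeightOneSpectrum (𝓞 K) × ℕ => (Q i vk.1).coeff vk.2) F‖ ≤ δ) →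
            ‖MvPolynomial.aeval
                (fun vk : HeightOneSpectrum (𝓞 K) × ℕ => (P vk.1).coeff vk.2) F‖ ≤
              (ℓ : ℝ) ^ (-(m : ℤ))) :
    ∃ ρ : FramedGaloisRep K (PadicAlgCl ℓ) n, ρ.toGaloisRep.IsSemisimple ∧
      ∀ v ∉ S, ((ℓ : ℕ) : 𝓞 K) ∉ v.asIdeal → ρ.IsUnramifiedAt v ∧ ρ.HasFrobCharpolyAt v (P v) := by
  classical
  choose r ρ' Q δ hδ hρ' hineq using happrox
  obtain ⟨T, hT_cont, hT_E, hT_frob, hT_n, hT_gt, hT_eq_of_c, htransfer⟩ :=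
    exists_transferableLimit K n E S hS P hP r ρ' Q δ hδ hρ' hineq
  -- Step 4: the limit pseudocharacter `Tr = -T_{n-1}`
  haveI : Nonempty (Fin n) := ⟨⟨0, hn⟩⟩
  have htr_coeff : ∀ M : Matrix (Fin n) (Fin n) (PadicAlgCl ℓ),
      M.trace = -M.charpoly.coeff (n - 1) := fun M => by
    rw [Matrix.trace_eq_neg_charpoly_coeff, Fintype.card_fin]
  let Tr : absoluteGaloisGroup K → PadicAlgCl ℓ := fun g => -T (n - 1) g
  -- (T1) `Tr 1 = n`, transferred from `tr 1 = n`
  have hTr_one : Tr 1 = n := by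
    have h := htransfer Unit (fun _ => 1)
      (MvPolynomial.X ((), n - 1) + MvPolynomial.C (n : ℤ)) ?_
    · rw [map_add, MvPolynomial.aeval_X, MvPolynomial.aeval_C, eq_intCast, Int.cast_natCast] at h
      change T (n - 1) 1 + (n : PadicAlgCl ℓ) = 0 at h
      show -T (n - 1) 1 = n
      linear_combination -h
    · intro m i
      rw [map_add, MvPolynomial.aeval_X, MvPolynomial.aeval_C, eq_intCast, Int.cast_natCast]
      have h2 := htr_coeff (1 : Matrix (Fin n) (Fin n) (PadicAlgCl ℓ))
      rw [Matrix.trace_one, Fintype.card_fin] at h2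
      have e : FramedRep.charpoly (ρ' m i) 1 = (1 : Matrix (Fin n) (Fin n) (PadicAlgCl ℓ)).charpoly := by
        rw [FramedRep.charpoly, map_one, Units.val_one]
      rw [e]
      linear_combination h2
  -- (T2) centrality: `gh` and `hg` have identical family data
  have hTr_comm : ∀ g h : absoluteGaloisGroup K, Tr (g * h) = Tr (h * g) := by
    intro g h
    show -T (n - 1) (g * h) = -T (n - 1) (h * g)
    rw [hT_eq_of_c (g * h) (h * g) (fun m i => ?_) (n - 1)]
    simp only [FramedRep.charpoly, map_mul, Units.val_mul]
    exact Matrix.charpoly_mul_comm _ _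
  -- (T3) the Frobenius identity, transferred from the universal identity over the free monoid
  have hTr_frob : ∀ x : Fin (n + 1) → absoluteGaloisGroup K, frobeniusS Tr (n + 1) x = 0 := by
    intro x
    obtain ⟨s, q, hq⟩ := MvPolynomial.exists_finset_rename
      (frobeniusS (fun w : FreeMonoid (Fin (n + 1)) =>
        (MvPolynomial.X w : MvPolynomial (FreeMonoid (Fin (n + 1))) ℤ)) (n + 1) FreeMonoid.of)
    have huniv : ∀ f : absoluteGaloisGroup K → PadicAlgCl ℓ, frobeniusS f (n + 1) x =
        MvPolynomial.aeval (fun a : {a // a ∈ s} => f (FreeMonoid.lift x a)) q := by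
      intro f
      rw [frobeniusS_eq_aeval_freeMonoid, hq, MvPolynomial.aeval_rename]
      rfl
    let F : MvPolynomial ({a // a ∈ s} × ℕ) ℤ :=
      MvPolynomial.bind₁ (fun a : {a // a ∈ s} => -MvPolynomial.X (a, n - 1)) q
    have hFeval : ∀ f : {a // a ∈ s} × ℕ → PadicAlgCl ℓ, MvPolynomial.aeval f F =
        MvPolynomial.aeval (fun a : {a // a ∈ s} => -f (a, n - 1)) q := by
      intro f
      have e : (fun a : {a // a ∈ s} => MvPolynomial.aeval f
          (-MvPolynomial.X (a, n - 1) : MvPolynomial ({a // a ∈ s} × ℕ) ℤ)) =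
          fun a : {a // a ∈ s} => -f (a, n - 1) := by
        funext a
        rw [map_neg, MvPolynomial.aeval_X]
      rw [MvPolynomial.aeval_bind₁, e]
    have h := htransfer {a // a ∈ s} (fun a => FreeMonoid.lift x a) F ?_
    · rw [hFeval] at h
      rw [huniv Tr]
      exact h
    · intro m i
      rw [hFeval, ← huniv (fun g => -(FramedRep.charpoly (ρ' m i) g).coeff (n - 1))]
      have e : (fun g => -(FramedRep.charpoly (ρ' m i) g).coeff (n - 1)) = fun g =>
          Matrix.trace (((ρ' m i).toMonoidHom g : GL (Fin n) (PadicAlgCl ℓ)) :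
            Matrix (Fin n) (Fin n) (PadicAlgCl ℓ)) := by
        funext g
        rw [htr_coeff]
        rfl
      rw [e]
      exact (Rouquier1996_prop_3_1_trace_holds (absoluteGaloisGroup K) (PadicAlgCl ℓ) n
        (ρ' m i).toMonoidHom).frobenius x
  have hTr_ps : IsPseudocharacter Tr n := ⟨hTr_one, hTr_comm, hTr_frob⟩
  have hTr_cont : Continuous Tr := (hT_cont _).neg
  have hTr_E : ∀ g, Tr g ∈ E := fun g => neg_mem (hT_E _ g)
  -- Step 5: Taylor's theorem (continuous form of Bellaïche–Chenevier)
  let Tc : ContinuousPseudocharacter (absoluteGaloisGroup K) (PadicAlgCl ℓ) n :=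
    ⟨Tr, hTr_ps, hTr_cont⟩
  obtain ⟨ρ, hss, htr, -⟩ :=
    BellaicheChenevier2009_continuous_rep_of_pseudocharacter_holds (absoluteGaloisGroup K) ℓ n E
      ‹FiniteDimensional ℚ_[ℓ] E› Tc (fun g => hTr_E g)
  -- Step 6: the characteristic polynomials of `ρ` are `χ g = X^n + ∑_{k<n} T_k(g) X^k`
  let χ : absoluteGaloisGroup K → (PadicAlgCl ℓ)[X] :=
    fun g => X ^ n + ∑ i : Fin n, C (T i g) * X ^ (i : ℕ)
  have hχ_monic : ∀ g, (χ g).Monic := fun g =>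
    monic_X_pow_add (degree_sum_fin_lt fun i : Fin n => T i g)
  have hχ_deg : ∀ g, (χ g).natDegree = n := by
    intro g
    show (X ^ n + ∑ i : Fin n, C (T i g) * X ^ (i : ℕ)).natDegree = n
    rw [natDegree_add_eq_left_of_degree_lt, natDegree_X_pow]
    rw [degree_X_pow]
    exact degree_sum_fin_lt fun i : Fin n => T i g
  have hχ_coeff : ∀ g k, (χ g).coeff k = T k g := by
    intro g k
    rcases lt_trichotomy k n with hk | rfl | hk
    · show (X ^ n + ∑ i : Fin n, C (T i g) * X ^ (i : ℕ)).coeff k = T k g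
      rw [coeff_add, coeff_X_pow, if_neg hk.ne, zero_add, finsetSum_coeff]
      simp only [coeff_C_mul_X_pow]
      rw [Fin.sum_univ_eq_sum_range (fun i => if k = i then T i g else 0) n, Finset.sum_ite_eq,
        if_pos (Finset.mem_range.2 hk)]
    · rw [hT_n]
      have h := (hχ_monic g).coeff_natDegree
      rwa [hχ_deg] at h
    · rw [hT_gt g k hk]
      exact coeff_eq_zero_of_natDegree_lt (by rw [hχ_deg]; exact hk)
  have hχ_roots : ∀ g, Multiset.card (χ g).roots = n := fun g => by
    rw [splits_iff_card_roots.1 (IsAlgClosed.splits (χ g)), hχ_deg]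
  -- Newton: power sums of roots as integer polynomials in the coefficients
  choose Ψ hΨ using fun j => LadicLimit.exists_mvPolynomial_psum_eq_aeval_esymm (PadicAlgCl ℓ) n j
  let vec : (PadicAlgCl ℓ)[X] → Fin n → PadicAlgCl ℓ :=
    fun R i => (-1) ^ ((i : ℕ) + 1) * R.coeff (n - ((i : ℕ) + 1))
  let Φ : ℕ → (PadicAlgCl ℓ)[X] → PadicAlgCl ℓ := fun j R => MvPolynomial.aeval (vec R) (Ψ j)
  have hΦ : ∀ j (R : (PadicAlgCl ℓ)[X]), R.Monic → R.natDegree = n →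
      Multiset.card R.roots = n → (R.roots.map (· ^ j)).sum = Φ j R := by
    intro j R hRm hRd hRr
    rw [hΨ j R.roots hRr]
    show MvPolynomial.aeval (fun i : Fin n => R.roots.esymm ((i : ℕ) + 1)) (Ψ j) =
      MvPolynomial.aeval (vec R) (Ψ j)
    suffices hfg : (fun i : Fin n => R.roots.esymm ((i : ℕ) + 1)) = vec R by rw [hfg]
    funext i
    have hi : (i : ℕ) + 1 ≤ n := i.2
    have h1 := Polynomial.coeff_eq_esymm_roots_of_card (p := R) (by rw [hRr, hRd])
      (k := n - ((i : ℕ) + 1)) (by rw [hRd]; omega)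
    rw [hRm.leadingCoeff, one_mul, hRd, show n - (n - ((i : ℕ) + 1)) = (i : ℕ) + 1 by omega] at h1
    show R.roots.esymm ((i : ℕ) + 1) = (-1) ^ ((i : ℕ) + 1) * R.coeff (n - ((i : ℕ) + 1))
    rw [h1, ← mul_assoc, ← pow_add, ← two_mul, pow_mul, neg_one_sq, one_pow, one_mul]
  -- traces of powers, transferred: `Tr(g^j) = p_j(roots of χ g)`
  have hpow : ∀ (g : absoluteGaloisGroup K) (j : ℕ), Tr (g ^ j) = Φ j (χ g) := by
    intro g j
    let w : Bool → absoluteGaloisGroup K := fun b => bif b then g ^ j else g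
    let F : MvPolynomial (Bool × ℕ) ℤ := -MvPolynomial.X (true, n - 1) -
      MvPolynomial.bind₁ (fun i : Fin n => MvPolynomial.C ((-1 : ℤ) ^ ((i : ℕ) + 1)) *
        MvPolynomial.X (false, n - ((i : ℕ) + 1))) (Ψ j)
    have hFeval : ∀ f : Bool × ℕ → PadicAlgCl ℓ, MvPolynomial.aeval f F =
        -f (true, n - 1) - MvPolynomial.aeval
          (fun i : Fin n => (-1) ^ ((i : ℕ) + 1) * f (false, n - ((i : ℕ) + 1))) (Ψ j) := by
      intro f
      have e : (fun i : Fin n => MvPolynomial.aeval f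
          (MvPolynomial.C ((-1 : ℤ) ^ ((i : ℕ) + 1)) * MvPolynomial.X (false, n - ((i : ℕ) + 1)) :
            MvPolynomial (Bool × ℕ) ℤ)) =
          fun i : Fin n => (-1) ^ ((i : ℕ) + 1) * f (false, n - ((i : ℕ) + 1)) := by
        funext i
        simp only [map_mul, map_pow, map_neg, map_one, MvPolynomial.aeval_X]
      simp only [F, map_sub, map_neg, MvPolynomial.aeval_X, MvPolynomial.aeval_bind₁, e]
    have h := htransfer Bool w F ?_
    · rw [hFeval] at h
      have e : vec (χ g) = fun i : Fin n => (-1) ^ ((i : ℕ) + 1) * T (n - ((i : ℕ) + 1)) g := by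
        funext i
        show (-1) ^ ((i : ℕ) + 1) * (χ g).coeff (n - ((i : ℕ) + 1)) = _
        rw [hχ_coeff]
      show -T (n - 1) (g ^ j) = MvPolynomial.aeval (vec (χ g)) (Ψ j)
      rw [e]
      exact sub_eq_zero.1 h
    · intro m i
      rw [hFeval]
      have h1 : -(FramedRep.charpoly (ρ' m i) (g ^ j)).coeff (n - 1) =
          ((((ρ' m i) g : GL (Fin n) (PadicAlgCl ℓ)) : Matrix (Fin n) (Fin n) (PadicAlgCl ℓ)) ^ j).trace := by
        rw [htr_coeff, FramedRep.charpoly, map_pow, Units.val_pow_eq_pow_val]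
      have h2 : ((((ρ' m i) g : GL (Fin n) (PadicAlgCl ℓ)) : Matrix (Fin n) (Fin n) (PadicAlgCl ℓ)) ^ j).trace =
          Φ j (FramedRep.charpoly (ρ' m i) g) := by
        rw [LadicLimit.matrix_trace_pow_eq_sum_roots_pow]
        exact hΦ j _ (Matrix.charpoly_monic _) (LadicLimit.natDegree_charpoly (ρ' m i) g)
          (LadicLimit.card_roots_charpoly (ρ' m i) g)
      change -(FramedRep.charpoly (ρ' m i) (g ^ j)).coeff (n - 1) -
        Φ j (FramedRep.charpoly (ρ' m i) g) = 0
      rw [h1, h2, sub_self]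
  have hcharpoly : ∀ g, FramedRep.charpoly ρ g = χ g := by
    intro g
    set A : Matrix (Fin n) (Fin n) (PadicAlgCl ℓ) :=
      ((ρ g : GL (Fin n) (PadicAlgCl ℓ)) : Matrix (Fin n) (Fin n) (PadicAlgCl ℓ)) with hAdef
    have hAm : A.charpoly.Monic := Matrix.charpoly_monic _
    have hAd : A.charpoly.natDegree = n := by
      rw [Matrix.charpoly_natDegree_eq_dim, Fintype.card_fin]
    have hAr : Multiset.card A.charpoly.roots = n := by
      rw [splits_iff_card_roots.1 (IsAlgClosed.splits _), hAd]
    have hroots : A.charpoly.roots = (χ g).roots := by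
      refine LadicLimit.multiset_eq_of_psum_eq hAr (hχ_roots g) fun j _ _ => ?_
      have h1 : (A.charpoly.roots.map (· ^ j)).sum = FramedRep.trace ρ (g ^ j) := by
        rw [← LadicLimit.matrix_trace_pow_eq_sum_roots_pow, FramedRep.trace, map_pow,
          Units.val_pow_eq_pow_val]
      rw [h1, htr (g ^ j), show (Tc : absoluteGaloisGroup K → PadicAlgCl ℓ) (g ^ j) = Tr (g ^ j) from rfl,
        hpow g j]
      exact (hΦ j (χ g) (hχ_monic g) (hχ_deg g) (hχ_roots g)).symm
    calc FramedRep.charpoly ρ g = A.charpoly := rfl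
      _ = (A.charpoly.roots.map fun a => X - C a).prod :=
          (prod_multiset_X_sub_C_of_monic_of_roots_card_eq hAm (by rw [hAr, hAd])).symm
      _ = ((χ g).roots.map fun a => X - C a).prod := by rw [hroots]
      _ = χ g := prod_multiset_X_sub_C_of_monic_of_roots_card_eq (hχ_monic g)
          (by rw [hχ_roots, hχ_deg])
  -- Step 7: unramifiedness (inertia does not move cells) and Frobenius (`T_k = coeff_k P_v` on `D`)
  refine ⟨ρ, hss, fun v hv hℓv => ⟨?_, ?_⟩⟩
  · intro 𝔓 h𝔓 τ hτ
    have hinv : ∀ g, χ (g * τ) = χ g := by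
      intro g
      have hTk : ∀ k, T k (g * τ) = T k g := hT_eq_of_c (g * τ) g fun m i => by
        simp only [FramedRep.charpoly, map_mul, (hρ' m i v hv hℓv).1 𝔓 h𝔓 τ hτ, mul_one]
      ext k
      rw [hχ_coeff, hχ_coeff, hTk]
    have e : ∀ h : absoluteGaloisGroup K, (FramedRep.toRepresentation ρ h).charpoly =
        FramedRep.charpoly ρ h := fun h => by
      have e1 : (FramedRep.toRepresentation ρ h :
          (Fin n → PadicAlgCl ℓ) →ₗ[PadicAlgCl ℓ] (Fin n → PadicAlgCl ℓ)) =
          Matrix.toLin' ((ρ h : GL (Fin n) (PadicAlgCl ℓ)) : Matrix (Fin n) (Fin n) (PadicAlgCl ℓ)) :=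
        LinearMap.ext fun w => by simp
      rw [e1, Matrix.charpoly_toLin']
      rfl
    have hmem : τ ∈ Literature.NumberTheory.Automorphic.charpolyKer (FramedRep.toRepresentation ρ) := by
      rw [Literature.NumberTheory.Automorphic.mem_charpolyKer_iff]
      intro g
      rw [e, e, hcharpoly, hcharpoly, hinv]
    have h1 := Literature.NumberTheory.Automorphic.apply_eq_one_of_mem_charpolyKer hss hmem
    have h2 : Matrix.toLin' ((ρ τ : GL (Fin n) (PadicAlgCl ℓ)) : Matrix (Fin n) (Fin n) (PadicAlgCl ℓ)) =
        Matrix.toLin' 1 := by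
      rw [Matrix.toLin'_one]
      refine LinearMap.ext fun w => ?_
      have hw := congr($h1 w)
      simpa using hw
    exact Units.ext (Matrix.toLin'.injective h2)
  · intro 𝔓 h𝔓 σ hσ
    rw [hcharpoly]
    ext k
    rw [hχ_coeff, hT_frob v hv hℓv 𝔓 h𝔓 σ hσ k]

/-- **Galois representations as algebra-valued `ℓ`-adic limits** (Taylor 1991 §1; Goldring–Koskivirta
2019 Thm. 3.5.6 and §11.1), all ranks, closed `∀`-form.  `K` a number field, `E/ℚ_ℓ` finite, `S` a
finite set of finite places, `P_v` (`v ∉ S`) prescribed polynomials with coefficients in `E`; if for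
every `m` there are finitely many continuous `ρ'_i : Γ_K → GL_n(ℚ̄_ℓ)`, unramified with Frobenius
characteristic polynomials `Q_i v` at every `v ∉ S`, `v ∤ ℓ`, and `δ > 0` such that every integer
polynomial in the good Frobenius-coefficient variables which is `δ`-small on all the `Q_i` is
`ℓ^{-m}`-small on `P` (the prescription modulo `ℓ^m` is a continuous ring homomorphism on the closed
`ℤ_ℓ`-algebra generated by the Frobenius data of the family), then there is a continuous SEMISIMPLE
`ρ : Γ_K → GL_n(ℚ̄_ℓ)`, unramified at every `v ∉ S`, `v ∤ ℓ`, with `charpoly ρ(Frob_v) = P_v`.  The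
single-approximant `exists_semisimple_galoisRep_of_ladicLimit` is the case `r = 1`, `δ = ℓ^{-m}`.
[cite: Taylor1991, §1 Theorem 1] [cite: GoldringKoskivirta2019, §11.1 and Thm. 3.5.6] -/
theorem exists_semisimple_galoisRep_of_algebraValuedLimit :
    ∀ (K : Type) [Field K] [NumberField K] (n ℓ : ℕ) [Fact ℓ.Prime]
      (E : IntermediateField ℚ_[ℓ] (PadicAlgCl ℓ)), FiniteDimensional ℚ_[ℓ] E →
      ∀ (S : Set (HeightOneSpectrum (𝓞 K))), S.Finite →
      ∀ (P : HeightOneSpectrum (𝓞 K) → (PadicAlgCl ℓ)[X]),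
      (∀ v ∉ S, ∀ k : ℕ, (P v).coeff k ∈ E) →
      (∀ m : ℕ, ∃ (r : ℕ) (ρ' : Fin r → FramedGaloisRep K (PadicAlgCl ℓ) n)
          (Q : Fin r → HeightOneSpectrum (𝓞 K) → (PadicAlgCl ℓ)[X]) (δ : ℝ), 0 < δ ∧
          (∀ i, ∀ v ∉ S, ((ℓ : ℕ) : 𝓞 K) ∉ v.asIdeal →
            (ρ' i).IsUnramifiedAt v ∧ (ρ' i).HasFrobCharpolyAt v (Q i v)) ∧
          ∀ F : MvPolynomial (HeightOneSpectrum (𝓞 K) × ℕ) ℤ,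
            (∀ vk ∈ F.vars, vk.1 ∉ S ∧ ((ℓ : ℕ) : 𝓞 K) ∉ vk.1.asIdeal) →
            (∀ i, ‖MvPolynomial.aeval
                (fun vk : HeightOneSpectrum (𝓞 K) × ℕ => (Q i vk.1).coeff vk.2) F‖ ≤ δ) →
              ‖MvPolynomial.aeval
                  (fun vk : HeightOneSpectrum (𝓞 K) × ℕ => (P vk.1).coeff vk.2) F‖ ≤
                (ℓ : ℝ) ^ (-(m : ℤ))) →
      ∃ ρ : FramedGaloisRep K (PadicAlgCl ℓ) n, ρ.toGaloisRep.IsSemisimple ∧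
        ∀ v ∉ S, ((ℓ : ℕ) : 𝓞 K) ∉ v.asIdeal → ρ.IsUnramifiedAt v ∧ ρ.HasFrobCharpolyAt v (P v) := by
  intro K _ _ n ℓ _ E hE S hS P hP happrox
  haveI := hE
  rcases Nat.eq_zero_or_pos n with rfl | hn
  · exact algebraValuedLimit_rank_zero K S P happrox
  · exact algebraValuedLimit_pos_rank K n hn E S hS P hP happrox

end Main

end Literature.NumberTheory.GaloisRepresentations

end
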